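import Literature.Probability.Percolation.TwoClusterExchange
import HarnessLib

/-!
# `NoHeavyLowerTail` (stmt-CriticalPhenomena-4575) — the DETACHMENT two-observer transfer
# (van den Berg–Häggström–Kahn Thm 1.5 with "lonely" replaced by "detached from the sink")

Support file (prover `prim-hp-2`, deletion–contraction line; `--supports stmt-CriticalPhenomena-4575`).  No definitions, no
named facts, no sorries.  `μ = prodBernoulli w` on a finite vertex type, `b` a fixed vertex (the sink; for the geometric-moment
form of the cumulative isolation lemma, `b` is the ghost of a uniform star sink on the relays, `Literature…GhostVertex`).

`Literature.Probability.Percolation.twoObserver_le_of_lonelier` (lonely := `|π(·)| ≤ j`) is the engine of the every-champion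
machinery of the level-`j` cumulative isolation lemma (merge stability at relay gluings, `CILOneSteiner.mergeStability_at_relay`;
hence `cil_champion_of_relayNeighbours`, `cil_oneSteiner_of`, `cil_twoSteiner_of`, `SteinerSkeleton.cil_of_componentDegLeTwo`).
This file proves the same transfer with the DETACHMENT events `{v ↮ b}` in place of the loneliness events — the input needed to
run that machinery for event gluing `P(o ↔ A, o ↮ b) ≤ max_a P(a ↮ b)` (sharp GM-CIL(1) on uniform star sinks):

* `EGTransfer.detachExchange` — for `s ≠ t`, `D = {s ↮ t}`, any `x`:
  `μ(D, t ↮ b, t ↔ x) · μ(D, s ↮ b) ≤ μ(D, t ↮ b) · μ(D, t ↔ x, s ↮ b)` (`twoClusterExchange` with `{t ↮ b}` of type `(+)`,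
  `{s ↮ b}` and `{t ↔ x}` of type `(−)`);
* `EGTransfer.detachTransfer` — its linearisation under `μ(s ↮ b) ≤ μ(t ↮ b)` (on `{s ↔ t}` the two detachment events coincide);
* `EGTransfer.twoObserver_detach_le` — **if `μ(y ↮ b) ≤ μ(c ↮ b)` then `μ(c ↮ x, c ↮ y, y ↮ b) ≤ μ(c ↮ x, c ↮ y, c ↮ b)`** for all
  vertices `x, y, c, b`; in particular (`EGTransfer.eventGluing_twoObserver`) the event-gluing two-observer inequality
  `μ(c ↮ x, c ↮ y, {x,y} ↔ A, x ↮ b, y ↮ b) ≤ μ(c ↮ x, c ↮ y, c ↮ b)` for every `y` no less detached than `c`.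
Exact numerics before formalisation (seat lab/gm2obs*.py): 0 violations in 2,256 general-sink and 6,294 star-sink triples.
-/

noncomputable section

namespace Summit.CriticalPhenomena.PercolationContinuityZ3.Theorems

open MeasureTheory Set Literature.Probability.LatticeModels Literature.Probability.Percolation
open scoped Classical BigOperators

namespace EGTransfer

variable {V : Type*}

/-- **Detachment exchange** (BHK 2006 Thm. 1.5 with detachment events).  For `s ≠ t`, vertices `x, b`, `D = {s ↮ t}`:
`μ(D ∩ ({t ↮ b} ∩ {t ↔ x})) · μ(D ∩ {s ↮ b}) ≤ μ(D ∩ {t ↮ b}) · μ(D ∩ ({t ↔ x} ∩ {s ↮ b}))`.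
[cite: VandenbergHaggstromKahn2005, Thm. 1.5 (p. 7) — corollary via `twoClusterExchange`] -/
theorem detachExchange [Fintype V] (w : Sym2 V → unitInterval) {s t : V} (hst : s ≠ t) (x b : V) :
    (prodBernoulli w).real ((openConn s t)ᶜ ∩ ((openConn t b : Set (BondConfig V))ᶜ ∩ openConn t x)) *
      (prodBernoulli w).real ((openConn s t)ᶜ ∩ (openConn s b : Set (BondConfig V))ᶜ) ≤
    (prodBernoulli w).real ((openConn s t)ᶜ ∩ (openConn t b : Set (BondConfig V))ᶜ) *
      (prodBernoulli w).real ((openConn s t)ᶜ ∩ (openConn t x ∩ (openConn s b : Set (BondConfig V))ᶜ)) := by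
  have key := twoClusterExchange w hst
    (A₁ := (openConn t b : Set (BondConfig V))ᶜ)
    (A₂ := (univ : Set (BondConfig V))) (B₁ := openConn t x)
    (B₂ := (openConn s b : Set (BondConfig V))ᶜ)
    (typePlus_not_openConn s t b) (fun _ _ _ _ _ => mem_univ _)
    (typeMinus_openConn s t x) (typeMinus_not_openConn s t b)
  simpa only [univ_inter, inter_univ] using key

/-- On `{s ↔ t}` the detachment events of `s` and `t` coincide. [folklore] -/
theorem not_openConn_sdiff_eq [Fintype V] (s t b : V) :
    (openConn t b : Set (BondConfig V))ᶜ \ (openConn s t)ᶜ = (openConn s b : Set (BondConfig V))ᶜ \ (openConn s t)ᶜ := by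
  ext ω
  simp only [mem_sdiff, mem_compl_iff, not_not]
  constructor
  · rintro ⟨h, hst⟩
    have hst' : (openGraph ω).Reachable s t := hst
    exact ⟨fun hsb => h (hst'.symm.trans hsb), hst⟩
  · rintro ⟨h, hst⟩
    have hst' : (openGraph ω).Reachable s t := hst
    exact ⟨fun htb => h (hst'.trans htb), hst⟩

/-- **Detachment transfer** (linearised exchange).  If `s ≠ t` and `μ(s ↮ b) ≤ μ(t ↮ b)` then for any vertex `x`:
`μ(D ∩ {t ↮ b} ∩ {t ↔ x}) ≤ μ(D ∩ {t ↔ x} ∩ {s ↮ b}) + (μ(t ↮ b) − μ(s ↮ b))`, `D = {s ↮ t}`.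
[cite: VandenbergHaggstromKahn2005, Thm. 1.5 (p. 7) — corollary] -/
theorem detachTransfer [Fintype V] (w : Sym2 V → unitInterval) {s t : V} (hst : s ≠ t) (x b : V)
    (hle : (prodBernoulli w).real (openConn s b : Set (BondConfig V))ᶜ ≤
      (prodBernoulli w).real (openConn t b : Set (BondConfig V))ᶜ) :
    (prodBernoulli w).real ((openConn s t)ᶜ ∩ ((openConn t b : Set (BondConfig V))ᶜ ∩ openConn t x)) ≤
      (prodBernoulli w).real ((openConn s t)ᶜ ∩ (openConn t x ∩ (openConn s b : Set (BondConfig V))ᶜ)) +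
      ((prodBernoulli w).real (openConn t b : Set (BondConfig V))ᶜ -
        (prodBernoulli w).real (openConn s b : Set (BondConfig V))ᶜ) := by
  set μ := prodBernoulli w with hμ
  set Rt : Set (BondConfig V) := (openConn t b : Set (BondConfig V))ᶜ with hRt
  set Rs : Set (BondConfig V) := (openConn s b : Set (BondConfig V))ᶜ with hRs
  set D : Set (BondConfig V) := (openConn s t)ᶜ with hD
  set X : Set (BondConfig V) := openConn t x with hX
  have hmeas : ∀ S : Set (BondConfig V), MeasurableSet S := fun S => (Set.toFinite S).measurableSet
  have key : μ.real (D ∩ (Rt ∩ X)) * μ.real (D ∩ Rs) ≤ μ.real (D ∩ Rt) * μ.real (D ∩ (X ∩ Rs)) :=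
    detachExchange w hst x b
  have hF2 : Rt \ D = Rs \ D := by rw [hRt, hRs, hD]; exact not_openConn_sdiff_eq s t b
  have hsplit_t : μ.real (Rt ∩ D) + μ.real (Rt \ D) = μ.real Rt := measureReal_inter_add_sdiff (hmeas D)
  have hsplit_s : μ.real (Rs ∩ D) + μ.real (Rs \ D) = μ.real Rs := measureReal_inter_add_sdiff (hmeas D)
  have h3 : μ.real (D ∩ Rt) = μ.real Rt - μ.real (Rt \ D) := by rw [inter_comm]; linarith
  have h2 : μ.real (D ∩ Rs) = μ.real Rs - μ.real (Rs \ D) := by rw [inter_comm]; linarith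
  have hm4 : μ.real (D ∩ (X ∩ Rs)) ≤ μ.real (D ∩ Rs) :=
    measureReal_mono (inter_subset_inter_right _ inter_subset_right)
  have hΔ : 0 ≤ μ.real Rt - μ.real Rs := by linarith
  by_cases h0 : μ.real (D ∩ Rs) = 0
  · have hm4' : μ.real (D ∩ (X ∩ Rs)) = 0 := le_antisymm (h0 ▸ hm4) measureReal_nonneg
    rw [hm4']
    have hm1 : μ.real (D ∩ (Rt ∩ X)) ≤ μ.real (D ∩ Rt) :=
      measureReal_mono (inter_subset_inter_right _ inter_subset_left)
    have h3' : μ.real (D ∩ Rt) = μ.real (D ∩ Rs) + (μ.real Rt - μ.real Rs) := by rw [h3, h2, hF2]; ring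
    linarith
  · have hpos : 0 < μ.real (D ∩ Rs) := lt_of_le_of_ne measureReal_nonneg (Ne.symm h0)
    have h' : μ.real (D ∩ (Rt ∩ X)) * μ.real (D ∩ Rs) ≤
        μ.real (D ∩ Rs) * (μ.real (D ∩ (X ∩ Rs)) + (μ.real Rt - μ.real Rs)) := by
      have h3' : μ.real (D ∩ Rt) = μ.real (D ∩ Rs) + (μ.real Rt - μ.real Rs) := by rw [h3, h2, hF2]; ring
      rw [h3'] at key
      nlinarith [measureReal_nonneg (μ := μ) (s := D ∩ (X ∩ Rs))]
    rw [mul_comm] at h'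
    exact le_of_mul_le_mul_left h' hpos

/-- **Detachment two-observer transfer ("the more detached terminal serves the glued observer").**  For vertices
`x, y, c, b` with `μ(y ↮ b) ≤ μ(c ↮ b)`:  `μ(c ↮ x, c ↮ y, y ↮ b) ≤ μ(c ↮ x, c ↮ y, c ↮ b)`.
[cite: VandenbergHaggstromKahn2005, Thm. 1.5 (p. 7) — corollary] -/
theorem twoObserver_detach_le [Fintype V] (w : Sym2 V → unitInterval) (x y c b : V)
    (hle : (prodBernoulli w).real (openConn y b : Set (BondConfig V))ᶜ ≤
      (prodBernoulli w).real (openConn c b : Set (BondConfig V))ᶜ) :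
    (prodBernoulli w).real {ω : BondConfig V | ω ∉ openConn c x ∧ ω ∉ openConn c y ∧ ω ∉ openConn y b} ≤
      (prodBernoulli w).real {ω : BondConfig V | ω ∉ openConn c x ∧ ω ∉ openConn c y ∧ ω ∉ openConn c b} := by
  set μ := prodBernoulli w with hμ
  set Rc : Set (BondConfig V) := (openConn c b : Set (BondConfig V))ᶜ with hRc
  set Ry : Set (BondConfig V) := (openConn y b : Set (BondConfig V))ᶜ with hRy
  set D : Set (BondConfig V) := (openConn y c)ᶜ with hD
  set X : Set (BondConfig V) := openConn c x with hX
  have hmeas : ∀ S : Set (BondConfig V), MeasurableSet S := fun S => (Set.toFinite S).measurableSet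
  by_cases hyc : y = c
  · subst hyc; exact le_rfl
  have hsymm : (openConn y c : Set (BondConfig V)) = openConn c y :=
    Set.ext fun _ => ⟨SimpleGraph.Reachable.symm, SimpleGraph.Reachable.symm⟩
  have hR : {ω : BondConfig V | ω ∉ openConn c x ∧ ω ∉ openConn c y ∧ ω ∉ openConn c b} = (Rc ∩ D) \ X := by
    ext ω
    simp only [hRc, hD, hX, mem_sdiff, mem_inter_iff, mem_compl_iff, mem_setOf_eq, hsymm]
    tauto
  have hL : {ω : BondConfig V | ω ∉ openConn c x ∧ ω ∉ openConn c y ∧ ω ∉ openConn y b} = (Ry ∩ D) \ X := by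
    ext ω
    simp only [hRy, hD, hX, mem_sdiff, mem_inter_iff, mem_compl_iff, mem_setOf_eq, hsymm]
    tauto
  rw [hR, hL]
  have hT : μ.real (D ∩ (Rc ∩ X)) ≤ μ.real (D ∩ (X ∩ Ry)) + (μ.real Rc - μ.real Ry) :=
    detachTransfer w hyc x b hle
  have hF2 : Rc \ D = Ry \ D := by rw [hRc, hRy, hD]; exact not_openConn_sdiff_eq y c b
  have hc1 : μ.real (Rc ∩ D) + μ.real (Rc \ D) = μ.real Rc := measureReal_inter_add_sdiff (hmeas D)
  have hy1 : μ.real (Ry ∩ D) + μ.real (Ry \ D) = μ.real Ry := measureReal_inter_add_sdiff (hmeas D)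
  have hc2 : μ.real (Rc ∩ D ∩ X) + μ.real ((Rc ∩ D) \ X) = μ.real (Rc ∩ D) :=
    measureReal_inter_add_sdiff (hmeas X)
  have hy2 : μ.real (Ry ∩ D ∩ X) + μ.real ((Ry ∩ D) \ X) = μ.real (Ry ∩ D) :=
    measureReal_inter_add_sdiff (hmeas X)
  have e1 : Rc ∩ D ∩ X = D ∩ (Rc ∩ X) := by
    ext ω; simp only [mem_inter_iff]; tauto
  have e4 : Ry ∩ D ∩ X = D ∩ (X ∩ Ry) := by
    ext ω; simp only [mem_inter_iff]; tauto
  rw [e1] at hc2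
  rw [e4] at hy2
  rw [hF2] at hc1
  linarith

/-- **Event-gluing two-observer inequality.**  For a finite set `A`, vertices `x, y, c, b` with `μ(y ↮ b) ≤ μ(c ↮ b)`:
`μ(c ↮ x, c ↮ y, (x ↔ A or y ↔ A), x ↮ b, y ↮ b) ≤ μ(c ↮ x, c ↮ y, c ↮ b)` — the detachment analogue of the level-`j`
two-observer transfer (`1 ≤ |π(x) ∪ π(y)| ≤ j` ↦ "`{x,y}` meets `A` but not the sink"). [cite: VandenbergHaggstromKahn2005, Thm. 1.5 (p. 7)] -/
theorem eventGluing_twoObserver [Fintype V] (w : Sym2 V → unitInterval) (A : Finset V) (x y c b : V)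
    (hle : (prodBernoulli w).real (openConn y b : Set (BondConfig V))ᶜ ≤
      (prodBernoulli w).real (openConn c b : Set (BondConfig V))ᶜ) :
    (prodBernoulli w).real {ω : BondConfig V | ω ∉ openConn c x ∧ ω ∉ openConn c y ∧
        (∃ a ∈ A, ω ∈ openConn x a ∨ ω ∈ openConn y a) ∧ ω ∉ openConn x b ∧ ω ∉ openConn y b} ≤
      (prodBernoulli w).real {ω : BondConfig V | ω ∉ openConn c x ∧ ω ∉ openConn c y ∧ ω ∉ openConn c b} := by
  refine le_trans (measureReal_mono ?_) (twoObserver_detach_le w x y c b hle)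
  rintro ω ⟨h1, h2, -, -, h5⟩
  exact ⟨h1, h2, h5⟩

end EGTransfer

end Summit.CriticalPhenomena.PercolationContinuityZ3.Theorems

end
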